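import Mathlib.Analysis.SpecialFunctions.Gaussian.PoissonSummation
import Literature.MathematicalPhysics.QuantumFieldTheory.VillainKernelAnalysis
import HarnessLib

/-!
# The Poisson summation (Fourier, dual) form of the Villain kernel:
# `v_β(θ) = (2πβ)^{-1/2} ∑_{m ∈ ℤ} e^{-m²/(2β)} e^{imθ}`

The periodised Gaussian `v_β(θ) = ∑_{n ∈ ℤ} exp(−(β/2)(θ + 2πn)²)`
(`Literature.MathematicalPhysics.QuantumFieldTheory.villainKernel`, the Villain edge/plaquette weight,
Fröhlich–Spencer 1982 (2.2)) is the heat kernel on the circle at time `1/β`; its Fourier series —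
the "transformation to the `ℤ`-valued dual model by Fourier (-series) transformation" with which
every duality / integer-current ("worm") representation of Villain models begins (FS82 §2.1 (i),
(2.3), (2.19); Wallin–Sørensen–Girvin–Young 1994 §II
`∑_J e^{-ΔτUJ²/2} e^{iJθ} = ∑_m √(2π/ΔτU) e^{-(θ-2πm)²/(2ΔτU)}`) — is obtained here from Mathlib's
Gaussian Poisson summation `Complex.tsum_exp_neg_quadratic`:

* `tsum_cexp_neg_sq_div_add_mul_I` — `∑_m exp(−m²/(2β) + iθm) = √(2πβ) · v_β(θ)` in `ℂ` (`β > 0`);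
* `summable_norm_villainFourierTerm` — the Fourier coefficients `e^{-m²/(2β)}/√(2πβ)` are
  absolutely summable;
* `hasSum_villainKernel_fourier` — `v_β(θ) = ∑_m (e^{-m²/(2β)}/√(2πβ)) e^{iθm}` (complex form, real
  angle), `hasSum_villainKernel_fourier_circle` — the same as a character series
  `∑_m c_m z^m = v_β(arg z)` on `U(1)` (the input format of the tree's character expansion
  `integral_coe_char_mul_prod_tsum`), and `hasSum_villainKernel_cos` — the real form
  `v_β(θ) = ∑_m (e^{-m²/(2β)}/√(2πβ)) cos(θm)`; all Fourier coefficients are POSITIVE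
  (`villainFourierCoeff_pos`), which is Griffiths' first inequality for Villain models in germ.

Theorems only; no definition and no named fact is introduced (the coefficient
`e^{-m²/(2β)}/√(2πβ)` is written out).

## References

* [FrohlichSpencerCMP1982] J. Fröhlich, T. Spencer, Comm. Math. Phys. 83 (1982) 411–454, §2.1 (i),
  §2.2 (2.2)–(2.3), §2.4 (2.19).
* [WallinEtAl1994] M. Wallin, E. Sørensen, S. Girvin, A. P. Young, Phys. Rev. B 49
  (1994) 12115, §II (the Poisson formula for the Villain weight).
-/

noncomputable section

open Complex Filter
open scoped Real Topology

namespace Literature.Probability.LatticeModels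

open Literature.MathematicalPhysics.QuantumFieldTheory

variable {β : ℝ}

/-- **Poisson summation for the Villain kernel** (`β > 0`, complex form):
`∑_{m ∈ ℤ} exp(−m²/(2β) + iθm) = √(2πβ) · v_β(θ)`, from Mathlib's `Complex.tsum_exp_neg_quadratic`
with `a = (2πβ)⁻¹`, `b = iθ/(2π)`. [cite: FrohlichSpencerCMP1982, §2.2 (2.2)–(2.3), §2.4 (2.19)] -/
theorem tsum_cexp_neg_sq_div_add_mul_I (hβ : 0 < β) (θ : ℝ) :
    ∑' m : ℤ, cexp (-((m : ℂ) ^ 2) / (2 * β) + I * θ * m) =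
      (Real.sqrt (2 * π * β) : ℂ) * (villainKernel β θ : ℂ) := by
  have hπ : (π : ℂ) ≠ 0 := ofReal_ne_zero.2 Real.pi_ne_zero
  have hβ' : (β : ℂ) ≠ 0 := ofReal_ne_zero.2 hβ.ne'
  have h2πβ : 0 < 2 * π * β := by positivity
  -- Mathlib's Poisson summation with `a = (2πβ)⁻¹`, `b = iθ/(2π)`
  set a : ℂ := (((2 * π * β)⁻¹ : ℝ) : ℂ) with ha
  have hare : 0 < a.re := by rw [ha, ofReal_re]; positivity
  have key := Complex.tsum_exp_neg_quadratic hare (I * θ / (2 * π))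
  -- the left-hand sides agree term by term
  have hL : ∀ m : ℤ, cexp (-π * a * (m : ℂ) ^ 2 + 2 * π * (I * θ / (2 * π)) * m) =
      cexp (-((m : ℂ) ^ 2) / (2 * β) + I * θ * m) := fun m => by
    congr 1
    rw [ha]
    push_cast
    field_simp
  -- the prefactor `1 / a^{1/2} = √(2πβ)`
  have hpre : 1 / a ^ (1 / 2 : ℂ) = (Real.sqrt (2 * π * β) : ℂ) := by
    rw [ha, show (1 / 2 : ℂ) = ((1 / 2 : ℝ) : ℂ) by push_cast; ring, ← ofReal_cpow (by positivity),
      Real.inv_rpow h2πβ.le, ← Real.sqrt_eq_rpow, one_div, ← ofReal_inv, inv_inv]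
  -- the right-hand summands are the (reflected) Villain terms
  have hR : ∀ m : ℤ, cexp (-π / a * ((m : ℂ) + I * (I * θ / (2 * π))) ^ 2) =
      ((Real.exp (-(β / 2) * (θ + 2 * π * (((-m : ℤ)) : ℝ)) ^ 2) : ℝ) : ℂ) := fun m => by
    rw [ofReal_exp]
    congr 1
    rw [ha]
    push_cast
    field_simp
    rw [I_sq]
    ring
  calc ∑' m : ℤ, cexp (-((m : ℂ) ^ 2) / (2 * β) + I * θ * m)
      = ∑' m : ℤ, cexp (-π * a * (m : ℂ) ^ 2 + 2 * π * (I * θ / (2 * π)) * m) :=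
        tsum_congr fun m => (hL m).symm
    _ = 1 / a ^ (1 / 2 : ℂ) * ∑' m : ℤ, cexp (-π / a * ((m : ℂ) + I * (I * θ / (2 * π))) ^ 2) := key
    _ = (Real.sqrt (2 * π * β) : ℂ) *
          ∑' m : ℤ, ((Real.exp (-(β / 2) * (θ + 2 * π * (((-m : ℤ)) : ℝ)) ^ 2) : ℝ) : ℂ) := by
        rw [hpre]; exact congrArg _ (tsum_congr hR)
    _ = (Real.sqrt (2 * π * β) : ℂ) * (villainKernel β θ : ℂ) := by
        congr 1
        rw [villainKernel, ofReal_tsum]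
        exact (Equiv.neg ℤ).tsum_eq (fun m : ℤ => ((Real.exp (-(β / 2) * (θ + 2 * π * (m : ℝ)) ^ 2) : ℝ) : ℂ))

/-- The Fourier coefficients of the Villain kernel are positive: `0 < e^{-m²/(2β)}/√(2πβ)` (`β > 0`).
[folklore] -/
theorem villainFourierCoeff_pos (hβ : 0 < β) (m : ℤ) :
    0 < Real.exp (-((m : ℝ) ^ 2) / (2 * β)) / Real.sqrt (2 * π * β) :=
  div_pos (Real.exp_pos _) (Real.sqrt_pos.2 (by positivity))

/-- The Fourier coefficients of the Villain kernel are absolutely summable (`β > 0`). [folklore] -/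
theorem summable_villainFourierCoeff (hβ : 0 < β) :
    Summable fun m : ℤ => Real.exp (-((m : ℝ) ^ 2) / (2 * β)) / Real.sqrt (2 * π * β) := by
  have hs := summable_villainKernel_term (β := 1 / (4 * π ^ 2 * β)) (by positivity) 0
  have heq : ∀ m : ℤ, Real.exp (-(1 / (4 * π ^ 2 * β) / 2) * (0 + 2 * π * (m : ℝ)) ^ 2) =
      Real.exp (-((m : ℝ) ^ 2) / (2 * β)) := fun m => by
    congr 1
    have hπ : (π : ℝ) ≠ 0 := Real.pi_ne_zero
    field_simp
    ring
  simp_rw [heq] at hs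
  exact hs.div_const _

/-- The complex Fourier terms have summable norms (`β > 0`). [folklore] -/
theorem summable_norm_villainFourierTerm (hβ : 0 < β) :
    Summable fun m : ℤ => ‖((Real.exp (-((m : ℝ) ^ 2) / (2 * β)) / Real.sqrt (2 * π * β) : ℝ) : ℂ)‖ := by
  refine (summable_villainFourierCoeff hβ).congr fun m => ?_
  rw [norm_real, Real.norm_eq_abs, abs_of_pos (villainFourierCoeff_pos hβ m)]

/-- **The Fourier series of the Villain kernel** (`β > 0`, real angle):
`v_β(θ) = ∑_{m ∈ ℤ} (e^{-m²/(2β)}/√(2πβ)) e^{iθm}` as a convergent series in `ℂ`.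
[cite: FrohlichSpencerCMP1982, §2.2 (2.3), §2.4 (2.19)] -/
theorem hasSum_villainKernel_fourier (hβ : 0 < β) (θ : ℝ) :
    HasSum (fun m : ℤ => ((Real.exp (-((m : ℝ) ^ 2) / (2 * β)) / Real.sqrt (2 * π * β) : ℝ) : ℂ) *
        cexp (((θ * m : ℝ) : ℂ) * I)) (villainKernel β θ : ℂ) := by
  have hsq : (Real.sqrt (2 * π * β) : ℂ) ≠ 0 :=
    ofReal_ne_zero.2 (Real.sqrt_pos.2 (by positivity)).ne'
  -- summability of the family
  have hsum : Summable fun m : ℤ =>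
      ((Real.exp (-((m : ℝ) ^ 2) / (2 * β)) / Real.sqrt (2 * π * β) : ℝ) : ℂ) * cexp (((θ * m : ℝ) : ℂ) * I) := by
    refine Summable.of_norm ((summable_norm_villainFourierTerm hβ).congr fun m => ?_)
    rw [norm_mul, norm_exp_ofReal_mul_I, mul_one]
  -- the value, from the Poisson identity
  have hterm : ∀ m : ℤ,
      ((Real.exp (-((m : ℝ) ^ 2) / (2 * β)) / Real.sqrt (2 * π * β) : ℝ) : ℂ) * cexp (((θ * m : ℝ) : ℂ) * I) =
        (Real.sqrt (2 * π * β) : ℂ)⁻¹ * cexp (-((m : ℂ) ^ 2) / (2 * β) + I * θ * m) := fun m => by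
    rw [Complex.exp_add, ← ofReal_intCast, show (-(((m : ℝ) : ℂ) ^ 2) / (2 * β) : ℂ) =
      (((-((m : ℝ) ^ 2) / (2 * β) : ℝ)) : ℂ) by push_cast; ring, ← ofReal_exp]
    push_cast
    field_simp
  refine hsum.hasSum_iff.2 ?_
  simp_rw [hterm]
  rw [tsum_mul_left, tsum_cexp_neg_sq_div_add_mul_I hβ θ, ← mul_assoc, inv_mul_cancel₀ hsq, one_mul]

/-- **The Villain kernel as a character series on `U(1)`**: for `z` on the unit circle,
`∑_{m ∈ ℤ} (e^{-m²/(2β)}/√(2πβ)) z^m = v_β(arg z)` (`β > 0`) — the input format of the tree's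
character expansion `integral_coe_char_mul_prod_tsum`. [cite: FrohlichSpencerCMP1982, §2.1 (i), §2.4 (2.19)] -/
theorem hasSum_villainKernel_fourier_circle (hβ : 0 < β) (z : Circle) :
    HasSum (fun m : ℤ => ((Real.exp (-((m : ℝ) ^ 2) / (2 * β)) / Real.sqrt (2 * π * β) : ℝ) : ℂ) * (z : ℂ) ^ m)
      (villainKernel β (Complex.arg (z : ℂ)) : ℂ) := by
  have hz : (z : ℂ) = cexp (((Complex.arg (z : ℂ)) : ℂ) * I) := by
    have h := norm_mul_exp_arg_mul_I (z : ℂ)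
    rw [Circle.norm_coe, ofReal_one, one_mul] at h
    exact h.symm
  refine (hasSum_villainKernel_fourier hβ (Complex.arg (z : ℂ))).congr_fun fun m => ?_
  congr 1
  rw [show cexp (((Complex.arg (z : ℂ) * m : ℝ) : ℂ) * I) =
      cexp ((m : ℂ) * (((Complex.arg (z : ℂ)) : ℂ) * I)) by push_cast; ring_nf, exp_int_mul, ← hz]

/-- **The cosine series of the Villain kernel** (`β > 0`):
`v_β(θ) = ∑_{m ∈ ℤ} (e^{-m²/(2β)}/√(2πβ)) cos(θm)` — a cosine series with POSITIVE coefficients.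
[cite: WallinEtAl1994, §II (Poisson formula)] -/
theorem hasSum_villainKernel_cos (hβ : 0 < β) (θ : ℝ) :
    HasSum (fun m : ℤ => Real.exp (-((m : ℝ) ^ 2) / (2 * β)) / Real.sqrt (2 * π * β) * Real.cos (θ * m))
      (villainKernel β θ) := by
  have h := hasSum_re (hasSum_villainKernel_fourier hβ θ)
  rw [ofReal_re] at h
  refine h.congr_fun fun m => ?_
  rw [re_ofReal_mul, exp_ofReal_mul_I_re]

end Literature.Probability.LatticeModels
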